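import Literature.Computability.QuantumComplexity.HadamardGadgetPadded
import Literature.Computability.Cryptography.QuantumCircuitDescFP
import HarnessLib

/-!
# The Hadamard gadget, V: the description of the padded gadget family in closed form

Topic `Literature/Computability/QuantumComplexity`; sequel of `HadamardGadgetPadded.lean`
(Bremner–Jozsa–Shepherd 2011, proof of Thm. 1, arXiv:1005.1407 p. 7; uniformity half). The
uniformity of an IQP family is the membership in `FP` of its description function
(`QCircuitFamily.isUniform_iff_descFn_mem_FP`, `Cryptography/QuantumCircuitDescFP.lean`). This
file computes the description function of `gadgetFamily (padFamily F)` as an explicit string: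

* `HGadget.opCode` — the gate code (`QGate.encode`) of a realised operation `Z v` / `T v` /
  `CZ v w` as a function of the numbers `v, w` (`encode_realize`: the code of `realize M ops` is
  `encList (ops.map opCode)` for operations in range);
* `HGadget.gadgetCodes n m C`, `HGadget.gadgetDesc n m C` — the list of op codes and the full
  description `⟨bin n, ⟨1^{m+D}, encList codes⟩⟩` of the `n`-th circuit of
  `gadgetFamily (padFamily F)` in terms of `n`, `m = F.ancillas n` and the gate list of `F.circ n`
  only (first layer `initOps`, slots `padOpsFrom`, last layer `lastOps`, relabelled by `rho n T`,
  then the `Z` on `T + 1` when `N ≥ 2`; `D = K₁ + N`, `T = N + K₁`, `K₁ = padKFrom N N gates`);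
* **`descFn_gadgetFamily_padFamily`**: the description function of `gadgetFamily (padFamily F)`
  IS `z ↦ gadgetDesc |z| (F.ancillas |z|) (F.circ |z|)`; hence
  (`isUniform_gadgetFamily_padFamily_of`) the family is uniform as soon as this string function
  and `n ↦ 1^{postLen n}` are polynomial-time — statements about strings and gate codes only, the
  subject of the sequel files.

## References

* M. J. Bremner, R. Jozsa, D. J. Shepherd, Proc. R. Soc. A 467 (2011) 459–472, arXiv:1005.1407,
  Thm. 1 (proof), p. 7.
* S. Arora, B. Barak, *Computational Complexity: A Modern Approach*, CUP 2009, §6.2 (descriptions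
  of circuit families), Remark 6.7.
-/

noncomputable section

namespace Literature.Computability.QuantumComplexity

open _root_.Computability Complexity Cryptography Matrix

namespace HGadget

variable {N M : ℕ}

/-! ### Gate codes of realised operations -/

/-- The code of the wire list of a placed gate. [cite: AroraBarak2009, §6.1] -/
def wiresCode (l : List ℕ) : List Bool := encodingListNatBool.encode l

/-- **The gate code of a realised operation** (`QGate.encode` of the placed `Z`/`T`/`CZ`; the
symbol numerals are `0` for `Z`, `1` for `CZ`, `2` for `T`). [cite: AroraBarak2009, §6.1] -/
def opCode : DOp → List Bool
  | .Z v => false :: boolPair (encodeNat 0) (wiresCode [v])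
  | .T v => false :: boolPair (encodeNat 2) (wiresCode [v])
  | .CZ v w => false :: boolPair (encodeNat 1) (wiresCode [v, w])

/-- The codes of the gates realising an in-range operation. [folklore] -/
theorem map_encode_realizeOp_of_below {op : DOp} (hop : op.Below M) :
    (realizeOp M op).map QGate.encode = [opCode op] := by
  cases op with
  | Z v =>
    have hv : v < M := hop
    simp only [realizeOp, dif_pos hv, List.map_cons, List.map_nil, QGate.encode, opCode, wiresCode]
    rfl
  | T v =>
    have hv : v < M := hop
    simp only [realizeOp, dif_pos hv, List.map_cons, List.map_nil, QGate.encode, opCode, wiresCode]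
    rfl
  | CZ v w =>
    have h : v < M ∧ w < M ∧ v ≠ w := hop
    simp only [realizeOp, dif_pos h, List.map_cons, List.map_nil, QGate.encode, opCode, wiresCode]
    rfl

/-- An out-of-range operation realises no gate. [folklore] -/
theorem realizeOp_of_not_below {op : DOp} (hop : ¬ op.Below M) : realizeOp M op = [] := by
  cases op with
  | Z v => exact dif_neg hop
  | T v => exact dif_neg hop
  | CZ v w => exact dif_neg hop

/-- The codes of the gates realising a list of in-range operations. [folklore] -/
theorem map_encode_flatMap_realizeOp {ops : List DOp} (hops : ∀ op ∈ ops, op.Below M) :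
    (ops.flatMap (realizeOp M)).map QGate.encode = ops.map opCode := by
  induction ops with
  | nil => rfl
  | cons op ops ih =>
    rw [List.flatMap_cons, List.map_append, map_encode_realizeOp_of_below (hops op (by simp)),
      ih (fun op' h => hops op' (by simp [h])), List.map_cons, List.singleton_append]

/-- **The code of a realised list of in-range operations is the pair list of the op codes.**
[cite: AroraBarak2009, §6.1] -/
theorem encode_realize {ops : List DOp} (hops : ∀ op ∈ ops, op.Below M) :
    (realize M ops).encode = encList (ops.map opCode) := by
  rw [QCircuit.encode_eq_encList, realize, map_encode_flatMap_realizeOp hops]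

/-- The code of a realised list followed by one possibly out-of-range `Z`. [folklore] -/
theorem encode_realize_append_Z {ops : List DOp} (hops : ∀ op ∈ ops, op.Below M) (v : ℕ) :
    (realize M (ops ++ [DOp.Z v])).encode =
      encList (ops.map opCode ++ if v < M then [opCode (DOp.Z v)] else []) := by
  rw [QCircuit.encode_eq_encList, realize, List.flatMap_append, List.flatMap_cons, List.flatMap_nil,
    List.append_nil, List.map_append, map_encode_flatMap_realizeOp hops]
  congr 2
  by_cases hv : v < M
  · rw [if_pos hv, map_encode_realizeOp_of_below (show (DOp.Z v).Below M from hv)]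
  · rw [if_neg hv, realizeOp_of_not_below (show ¬ (DOp.Z v).Below M from hv), List.map_nil]

/-! ### No gates on zero wires -/

/-- There is no placed Clifford+`T` gate on `0` wires. [folklore] -/
theorem qgate_zero_elim (g : QGate cliffordT 0) : False := by
  cases g with
  | gate g e => cases g <;> exact (e ⟨0, by decide⟩).elim0
  | oracle k e => exact (e 0).elim0

/-- A circuit on `0` wires has no gates. [folklore] -/
theorem gates_eq_nil_of_zero (C : QCircuit cliffordT 0) : C.gates = [] := by
  cases h : C.gates with
  | nil => rfl
  | cons g gs => exact (qgate_zero_elim g).elim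

/-! ### The description of the padded gadget family -/

section Desc

variable {n m : ℕ}

/-- The op codes of the `n`-th circuit of `gadgetFamily (padFamily F)`, as a function of the
gate list of `C = F.circ n` (`N = n + m`, `K₁ = padKFrom N N gates`, `T = N + K₁`): first layer,
slots, last layer, all relabelled by `rho n T`, then the polarity flip `Z (T + 1)` when `N ≥ 2`
(for `N ≤ 1` it is out of range and realises no gate).
[cite: BremnerJozsaShepherdPRSA2011, Thm. 1 (proof)] -/
def gadgetCodes (n m : ℕ) (C : QCircuit cliffordT (n + m)) : List (List Bool) :=
  ((initOps (n + m) ++ padOpsFrom (n + m) (n + m) C.gates ++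
      lastOps (n + m) (padKFrom (n + m) (n + m) C.gates)).map
    fun op => opCode (op.map (rho n (n + m + padKFrom (n + m) (n + m) C.gates)))) ++
  (if 1 < n + m then [opCode (DOp.Z (n + m + padKFrom (n + m) (n + m) C.gates + 1))] else [])

/-- **The description of the `n`-th circuit of `gadgetFamily (padFamily F)`** in closed form:
`⟨bin n, ⟨1^{m + (K₁ + N)}, encList (gadgetCodes n m C)⟩⟩`. [cite: AroraBarak2009, §6.2] -/
def gadgetDesc (n m : ℕ) (C : QCircuit cliffordT (n + m)) : List Bool :=
  boolPair (encodeNat n) (boolPair (unaryEncodeNat (m + (padKFrom (n + m) (n + m) C.gates + (n + m))))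
    (encList (gadgetCodes n m C)))

/-- `D = K₁ + N` for the padded circuit. [folklore] -/
theorem freshCount_padCirc (C : QCircuit cliffordT (n + m)) :
    freshCount (padCirc C) = padKFrom (n + m) (n + m) C.gates + (n + m) := by
  rw [freshCount_eq, preCount_padCirc]

/-- `T` of the padded circuit. [folklore] -/
theorem TC_padCirc (C : QCircuit cliffordT (n + m)) :
    TC (padCirc C) = n + m + padKFrom (n + m) (n + m) C.gates := by
  rw [TC, preCount_padCirc]

/-- The relabelled operations of the padded circuit are in range (the relabelling is a
bijection of `[0, M)` as soon as `N ≥ 1`, and for `N = 0` there is nothing to relabel). [folklore] -/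
theorem opsAt_prefix_below (C : QCircuit cliffordT (n + m)) :
    ∀ op ∈ ((sfinal (padCirc C)).ops).map (DOp.map (rho n (TC (padCirc C)))),
      op.Below (n + (m + freshCount (padCirc C))) := by
  intro op hop
  obtain ⟨op, hop', rfl⟩ := List.mem_map.1 hop
  have hb : op.Below (n + m + freshCount (padCirc C)) := (final_wf _).ops_below op hop'
  rcases Nat.eq_zero_or_pos (n + m) with hN | hN
  · -- no wires: no gates, no operations
    exfalso
    have hn : n = 0 := by omega
    have hm : m = 0 := by omega
    subst hn; subst hm
    rw [ops_sfinal_padCirc, gates_eq_nil_of_zero C] at hop'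
    simp [initOps, padOpsFrom, lastOps] at hop'
  · have hT : TC (padCirc C) < n + m + freshCount (padCirc C) := by
      rw [TC, freshCount_eq]; omega
    have hnT : n ≤ TC (padCirc C) := by rw [TC]; omega
    refine hb.map (fun v hv => ?_) (fun v w hv hw h => ?_)
    · have := rho_lt (n := n) hT hv; omega
    · have := congrArg (rhoInv n (TC (padCirc C))) h
      rwa [rhoInv_rho hnT, rhoInv_rho hnT] at this

/-- **The code of the gadget circuit of the padded circuit.** [cite: BremnerJozsaShepherdPRSA2011, Thm. 1 (proof)] -/
theorem encode_diagAt_padCirc (C : QCircuit cliffordT (n + m)) :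
    (diagAt (padCirc C)).encode = encList (gadgetCodes n m C) := by
  have hρ : rho n (TC (padCirc C)) (TC (padCirc C) + 1) = TC (padCirc C) + 1 := by
    unfold rho; split_ifs <;> omega
  rw [diagAt, opsAt, List.map_append, List.map_cons, List.map_nil,
    show (DOp.Z (TC (padCirc C) + 1)).map (rho n (TC (padCirc C))) = DOp.Z (TC (padCirc C) + 1) from
      congrArg DOp.Z hρ,
    encode_realize_append_Z (opsAt_prefix_below C), gadgetCodes, ops_sfinal_padCirc, TC_padCirc,
    freshCount_padCirc, List.map_map]
  congr 2
  by_cases h : 1 < n + m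
  · rw [if_pos (by omega), if_pos h]
  · rw [if_neg (by omega), if_neg h]

/-- **The description function of the padded gadget family in closed form.**
[cite: AroraBarak2009, §6.2] -/
theorem descFn_gadgetFamily_padFamily (F : QCircuitFamily cliffordT) (z : List Bool) :
    (gadgetFamily (padFamily F)).toIQPFamily.toQCircuitFamily.descFn z =
      gadgetDesc z.length (F.ancillas z.length) (F.circ z.length) := by
  rw [QCircuitFamily.descFn_eq, gadgetDesc]
  show boolPair (encodeNat z.length) (boolPair
    (unaryEncodeNat (F.ancillas z.length + freshCount (padCirc (F.circ z.length))))
      (diagAt (padCirc (F.circ z.length))).encode) = _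
  rw [encode_diagAt_padCirc, freshCount_padCirc]

end Desc

/-! ### Uniformity from the two string functions -/

/-- **Uniformity of the padded gadget family, reduced to strings**: if the closed-form
description `z ↦ gadgetDesc |z| (F.ancillas |z|) (F.circ |z|)` is in `FP` and the block size
`n ↦ 1^{postLenAt (padCirc (F.circ n))}` is polynomial-time in unary, then
`gadgetFamily (padFamily F)` is uniform. [cite: AroraBarak2009, §6.2 (P-uniform families), Remark 6.7] -/
theorem isUniform_gadgetFamily_padFamily_of (F : QCircuitFamily cliffordT)
    (hdesc : (fun z : List Bool => gadgetDesc z.length (F.ancillas z.length) (F.circ z.length)) ∈ FP)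
    (hpost : PolyTimeComputable unaryEncodeNat unaryEncodeNat fun n => postLenAt (padCirc (F.circ n))) :
    (gadgetFamily (padFamily F)).IsUniform := by
  refine ⟨?_, hpost⟩
  show (gadgetFamily (padFamily F)).toIQPFamily.toQCircuitFamily.IsUniform
  rw [QCircuitFamily.isUniform_iff_descFn_mem_FP]
  have h : (gadgetFamily (padFamily F)).toIQPFamily.toQCircuitFamily.descFn =
      fun z : List Bool => gadgetDesc z.length (F.ancillas z.length) (F.circ z.length) :=
    funext (descFn_gadgetFamily_padFamily F)
  rw [h]
  exact hdesc

/-- **The Hadamard gadget reduction, reduced to two string functions per family.** If for every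
uniform oracle-free Clifford+`T` family the closed-form description of its padded gadget family
is in `FP` and its post-selection block size is polynomial-time in unary, then
`PostBQPWith ε ⊆ PostIQPWith ε` for every `ε`. [cite: BremnerJozsaShepherdPRSA2011, Thm. 1 (proof)] -/
theorem PostBQPWith_subset_PostIQPWith_of_desc
    (h : ∀ F : QCircuitFamily cliffordT, F.IsOracleFree → F.IsUniform →
      (fun z : List Bool => gadgetDesc z.length (F.ancillas z.length) (F.circ z.length)) ∈ FP ∧
      PolyTimeComputable unaryEncodeNat unaryEncodeNat fun n => postLenAt (padCirc (F.circ n))) :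
    PostBQPWith_subset_PostIQPWith :=
  PostBQPWith_subset_PostIQPWith_of_padGadgetUniform fun F hF hFu =>
    isUniform_gadgetFamily_padFamily_of F (h F hF hFu).1 (h F hF hFu).2

end HGadget

end Literature.Computability.QuantumComplexity
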